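import Mathlib
import HarnessLib
import Summits.QuantumFields.YangMills.Theorems.LangevinControlUVOSLegsFromFemtoAndGapStubUpgradeGivens

/-!
# All `(x⁰,x¹)`-rotations from one Pythagorean angle (closed subgroups of `ℝ` and Niven's theorem)

Support file (registered stub `stub_rotNiven` of the crux `ContinuumLegGivenGap`
`Summit.QuantumFields.YangMills.Theses.ConvexGribovBody.ContinuumLegGivenGap`, line `Sketch`): pure Euclidean
geometry over Mathlib and the tree's rotation `ρ t = planeRot (d := 3) 0 t` of the `(x⁰,x¹)`-plane of `ℝ⁴`
(`Literature.MathematicalPhysics.QuantumFieldTheory.OSLorentzInvariance`). No definitions, no notation.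

**Main theorem** `stub_rotNiven`. Let `P` be a predicate on the linear isometries of `ℝ⁴` closed under
composition and inverses and holding at the identity, such that the angle set `{t | P (ρ t)}` is closed and
contains some `θ` with `cos θ = 3/5`. Then `P (ρ t)` for every `t`.

Proof (a `2π`-variant of the tree's `OSLegsFromFemtoAndGap.Upgrade.rho_all_of_closed`, which assumed in
addition `P (ρ (π/2))`). The angle set `H` is an additive subgroup of `ℝ` (`ρ` is a one-parameter group:
tree `rho_add`, `rho_zero`, `rho_symm`), closed by hypothesis, and contains `θ` and `2π` (`ρ (2π) = ρ 0 = 1`,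
coordinates `planeRot_apply`). By Mathlib `AddSubgroup.dense_or_cyclic`, either `H` is dense — then, being
closed, `H = ℝ` — or `H = ℤ a` is cyclic: then `2π = m a` with `m ≠ 0` and `θ = k a`, so `θ = (2k/m) π` is a
rational multiple of `π` with the rational cosine `3/5 ∉ {0, ±1/2, ±1}`, contradicting Niven's theorem
(Mathlib `niven`).

References: I. Niven, Irrational Numbers (1956), Cor. 3.12 (Mathlib `niven`); folklore (closed subgroups
of `ℝ`).
-/

noncomputable section

namespace Summit.QuantumFields.YangMills.Theorems.ContinuumLegGivenGap

open Literature.MathematicalPhysics.QuantumFieldTheory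
open Summit.QuantumFields.YangMills.Theorems.OSLegsFromFemtoAndGap.Upgrade

/-- **All `(x⁰,x¹)`-rotations from one Pythagorean angle** (registered stub `stub_rotNiven`): a predicate on
the linear isometries of `ℝ⁴` closed under composition and inverses and holding at the identity, whose angle
set along the `(x⁰,x¹)`-rotations `planeRot (d := 3) 0 t` is closed and contains some `θ` with `cos θ = 3/5`,
holds on every `(x⁰,x¹)`-rotation: the angle set is a closed additive subgroup of `ℝ` containing `2π` (the
rotation by `2π` is the identity) and `θ`; if it were cyclic, `θ` would be a rational multiple of `π` with
`cos θ = 3/5 ∉ {0, ±1/2, ±1}`, contradicting Niven's theorem (Mathlib `niven`); so it is dense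
(`AddSubgroup.dense_or_cyclic`), hence all of `ℝ`. [folklore] -/
theorem stub_rotNiven :
    ∀ (P : (EuclideanSpace ℝ (Fin 4) ≃ₗᵢ[ℝ] EuclideanSpace ℝ (Fin 4)) → Prop),
      (∀ A B, P A → P B → P (A.trans B)) → (∀ A, P A → P A.symm) →
      P (LinearIsometryEquiv.refl ℝ (EuclideanSpace ℝ (Fin 4))) →
      IsClosed {t : ℝ | P (Literature.MathematicalPhysics.QuantumFieldTheory.planeRot (d := 3) 0 t)} →
      (∃ θ : ℝ, Real.cos θ = 3 / 5 ∧ P (Literature.MathematicalPhysics.QuantumFieldTheory.planeRot (d := 3) 0 θ)) →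
      ∀ t : ℝ, P (Literature.MathematicalPhysics.QuantumFieldTheory.planeRot (d := 3) 0 t) := by
  intro P hmul hinv hone hclosed hθ t
  -- the angle set is an additive subgroup of `ℝ` (`ρ` is a one-parameter group)
  let H : AddSubgroup ℝ :=
    { carrier := {t : ℝ | P (planeRot (d := 3) 0 t)}
      zero_mem' := by
        show P (planeRot (d := 3) 0 0)
        rw [rho_zero]
        exact hone
      add_mem' := fun {a b} ha hb => by
        show P (planeRot (d := 3) 0 (a + b))
        rw [rho_add]
        exact hmul _ _ ha hb
      neg_mem' := fun {a} ha => by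
        show P (planeRot (d := 3) 0 (-a))
        rw [← rho_symm]
        exact hinv _ ha }
  obtain ⟨θ, hcos, hPθ⟩ := hθ
  -- `ρ (2π) = ρ 0 = 1`, so `2π` is in the angle set
  have h2π : P (planeRot (d := 3) 0 (2 * Real.pi)) := by
    have h : planeRot (d := 3) 0 (2 * Real.pi) = planeRot (d := 3) 0 0 := by
      ext x j
      simp only [planeRot_apply, Real.cos_two_pi, Real.sin_two_pi, Real.cos_zero, Real.sin_zero]
    rw [h, rho_zero]
    exact hone
  have hH : (H : Set ℝ) = Set.univ := by
    rcases AddSubgroup.dense_or_cyclic H with hd | ⟨a, ha⟩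
    · -- dense and closed: everything
      have hc : IsClosed (H : Set ℝ) := hclosed
      rw [← hc.closure_eq, hd.closure_eq]
    · -- cyclic: `θ ∈ ℚ π` with `cos θ = 3/5`, contradicting Niven's theorem
      exfalso
      have h2π' : (2 * Real.pi : ℝ) ∈ H := h2π
      have hθ' : θ ∈ H := hPθ
      rw [ha, AddSubgroup.mem_closure_singleton] at h2π' hθ'
      obtain ⟨m, hm⟩ := h2π'
      obtain ⟨k, hk⟩ := hθ'
      rw [zsmul_eq_mul] at hm hk
      have hm0 : (m : ℝ) ≠ 0 := by
        rintro h0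
        rw [h0, zero_mul] at hm
        linarith [Real.pi_pos]
      have hθq : θ = ((2 * k / m : ℚ) : ℝ) * Real.pi := by
        push_cast
        rw [div_mul_eq_mul_div, eq_div_iff hm0]
        linear_combination (-(m : ℝ)) * hk + (k : ℝ) * hm
      have h1 : Real.cos θ ∈ ({-1, -1 / 2, 0, 1 / 2, 1} : Set ℝ) :=
        niven ⟨2 * k / m, hθq⟩ ⟨3 / 5, by rw [hcos]; push_cast; ring⟩
      rw [hcos] at h1
      simp only [Set.mem_insert_iff, Set.mem_singleton_iff] at h1
      norm_num at h1
  exact (hH ▸ Set.mem_univ t : t ∈ (H : Set ℝ))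

end Summit.QuantumFields.YangMills.Theorems.ContinuumLegGivenGap

end
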